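import Literature.Probability.Percolation.FiniteClustersPercolationOneArm
import Summits.CriticalPhenomena.PercolationContinuityZ3.Theorems.PercBurnResprinkleVacantSetPercolatesCoarseToVacant
import HarnessLib

/-!
# Gluing by uniqueness: good blocks percolate ⟹ the vacant set percolates

Crux `VacantSetPercolates` (item stmt-CriticalPhenomena-7205), line `sheet-plane-product`, stub
`stub_blocksToVacant`.  One-scale static renormalisation of the vacant set `X = ℤ³[{C finite}]`
through the local proxy `quietSet R ω` (an `R`-quiet site has a finite open cluster,
`finite_openCluster_of_mem_quietSet`).  A coarse site `a ∈ ℤ²` is *good* if its cube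
`n a + [0, n]³` (corner in the coordinate plane, `planeEmb 3`) is crossed in every direction by
lattice paths of quiet sites, and its doubled cube `n a + [-n, 2n]³` contains no two far-reaching
quiet pieces that are not joined inside it (local uniqueness); a coarse edge of `ℤ²` is open iff
both endpoints are good.  The deterministic consequence proved here (gluing by uniqueness, no
planarity and no path intersections): an infinite open coarse cluster of the coarse origin yields
an infinite connected subset of `X`, i.e. `ω ∈ finiteClustersPercolate (zdGraph 3)`.

The argument: for an open coarse edge `{a, b}` the cube of `b` lies in both doubled cubes, so the
start of a crossing of the cube of `b` is far-reaching for `a` and for `b`; uniqueness in the two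
doubled cubes then joins every far-reaching point of `a` to every far-reaching point of `b` through
quiet sites.  Induction along coarse paths joins one base point `x₀` to a point of the cube of
every coarse site of the cluster; a lattice site lies in finitely many cubes (`n ≥ 1`), so
infinitely many coarse sites give infinitely many sites joined to `x₀` through quiet sites, all in
the `X`-cluster of `x₀` (`reachable_finiteClusters_of_pathIn`).

References: G. R. Grimmett, A. E. Holroyd, G. Kozma, *Percolation of finite clusters and infinite
surfaces*, Math. Proc. Cambridge Philos. Soc. 156 (2014), §4 (proof of Thm. 5, block argument);
P. Antal, A. Pisztora, *On the chemical distance for supercritical Bernoulli percolation*, Ann.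
Probab. 24 (1996), §2 (static renormalisation: crossing clusters and uniqueness in blocks).
-/

noncomputable section

namespace Summit.CriticalPhenomena.PercolationContinuityZ3.Theorems

open MeasureTheory Set Literature.Probability.Percolation Literature.Probability.LatticeModels

namespace SPPBlocksToVacant

/-- Corners `n a`, `n b` (embedded in `ℤ³`) of neighbouring coarse sites `a ∼ b` are within `n`
in each coordinate. [folklore] -/
theorem abs_planeEmb_smul_sub_le (n : ℕ) {a b : Site 2} (h : (zdGraph 2).Adj a b) (i : Fin 3) :
    |planeEmb 3 ((n : ℤ) • b) i - planeEmb 3 ((n : ℤ) • a) i| ≤ (n : ℤ) := by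
  have hba : planeEmb 3 ((n : ℤ) • b) i - planeEmb 3 ((n : ℤ) • a) i =
      planeEmb 3 ((n : ℤ) • (b - a)) i := by
    rw [smul_sub, map_sub, Pi.sub_apply]
  rw [hba, planeEmb_apply]
  split_ifs with hi
  · rw [Pi.smul_apply, smul_eq_mul, Pi.sub_apply, abs_mul, Nat.abs_cast]
    exact mul_le_of_le_one_right (Nat.cast_nonneg n) (DCT16.abs_sub_le_one_of_adj h.symm _)
  · rw [abs_zero]
    exact Nat.cast_nonneg n

/-- The cube of a coarse neighbour `b ∼ a` lies in the doubled cube of `a`. [folklore] -/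
theorem cube_subset_bigCube (n : ℕ) {a b : Site 2} (h : (zdGraph 2).Adj a b) :
    {x : Site 3 | ∀ i, planeEmb 3 ((n : ℤ) • b) i ≤ x i ∧
      x i ≤ planeEmb 3 ((n : ℤ) • b) i + (n : ℤ)} ⊆
      {x : Site 3 | ∀ i, planeEmb 3 ((n : ℤ) • a) i - (n : ℤ) ≤ x i ∧
        x i ≤ planeEmb 3 ((n : ℤ) • a) i + 2 * (n : ℤ)} := by
  intro x hx i
  have h1 := abs_planeEmb_smul_sub_le n h i
  rw [abs_le] at h1
  obtain ⟨h2, h3⟩ := hx i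
  constructor <;> linarith [h1.1, h1.2]

/-- A cube lies in its own doubled cube. [folklore] -/
theorem cube_subset_bigCube_self (n : ℕ) (a : Site 2) :
    {x : Site 3 | ∀ i, planeEmb 3 ((n : ℤ) • a) i ≤ x i ∧
      x i ≤ planeEmb 3 ((n : ℤ) • a) i + (n : ℤ)} ⊆
      {x : Site 3 | ∀ i, planeEmb 3 ((n : ℤ) • a) i - (n : ℤ) ≤ x i ∧
        x i ≤ planeEmb 3 ((n : ℤ) • a) i + 2 * (n : ℤ)} := by
  intro x hx i
  have hn : (0 : ℤ) ≤ n := Nat.cast_nonneg n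
  obtain ⟨h2, h3⟩ := hx i
  constructor <;> linarith

/-- **Finite-to-one.** A site of `ℤ³` lies in the cube `n a + [0, n]³` of only finitely many
coarse sites `a` (`n ≥ 1`). [folklore] -/
theorem finite_fibre3 {n : ℕ} (hn : 1 ≤ n) (x : Site 3) :
    {a : Site 2 | ∀ i, planeEmb 3 ((n : ℤ) • a) i ≤ x i ∧
      x i ≤ planeEmb 3 ((n : ℤ) • a) i + (n : ℤ)}.Finite := by
  have h23 : 2 ≤ 3 := by norm_num
  refine (CoarseToVacant.finite_fibre hn (fun l => x (Fin.castLE h23 l))).subset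
    fun a ha l => ?_
  have h := ha (Fin.castLE h23 l)
  rwa [planeEmb_apply_castLE, Pi.smul_apply, smul_eq_mul] at h

/-- **Induction along coarse paths (gluing by uniqueness).** If the far-reaching points of a good
block are pairwise joined (`hjoin`) and every coarse edge `a ∼ b` has a good far end and carries a
point far-reaching for both blocks (`hedge`), then every block reachable from a good block `o` is
good and all its far-reaching points are joined to any far-reaching point `x₀` of `o`.
[cite: GrimmettHolroydKozma2014, §4 (proof of Thm. 5, block argument)] -/
theorem pathIn_of_reachable {V W : Type*} {G₂ : SimpleGraph V} {G : SimpleGraph W} {S : Set W}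
    {Good : V → Prop} {Far : V → W → Prop}
    (hjoin : ∀ a x y, Good a → Far a x → Far a y → PathIn G S x y)
    (hedge : ∀ a b, G₂.Adj a b → Good b ∧ ∃ z, Far a z ∧ Far b z)
    {o : V} {x₀ : W} (ho : Good o) (h0 : Far o x₀) {a : V} (ha : G₂.Reachable o a) :
    Good a ∧ ∀ x, Far a x → PathIn G S x₀ x := by
  rw [SimpleGraph.reachable_iff_reflTransGen] at ha
  induction ha with
  | refl => exact ⟨ho, fun x hx => hjoin o x₀ x ho h0 hx⟩
  | @tail b c _ hbc ih =>
    obtain ⟨hc, z, hbz, hcz⟩ := hedge b c hbc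
    exact ⟨hc, fun x hx => (ih.2 z hbz).trans (hjoin c z x hc hcz hx)⟩

/-- **Gluing by uniqueness, cubes abstracted.** For the coarse bond configuration on `ℤ²` whose
open edges are the lattice edges with both endpoints good (cubes `cube a = n a + [0, n]³` crossed
in every direction by quiet lattice paths, no two unjoined far-reaching quiet pieces in the doubled
cube `big a = n a + [-n, 2n]³`), an infinite open cluster of the coarse origin forces an infinite
connected set of GHK's graph `X` in `ℤ³` (`ω ⊆ E(ℤ³)`, `n ≥ 1`).
[cite: GrimmettHolroydKozma2014, §4 (proof of Thm. 5, "there exists an infinite component in Γ")] -/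
theorem mem_finiteClustersPercolate_of_blocks {n R : ℕ} {ω : BondConfig (Site 3)} (hn : 1 ≤ n)
    (hω : ω ⊆ (zdGraph 3).edgeSet) (cube big : Site 2 → Set (Site 3))
    (hcube : ∀ a, cube a = {x : Site 3 | ∀ i, planeEmb 3 ((n : ℤ) • a) i ≤ x i ∧
      x i ≤ planeEmb 3 ((n : ℤ) • a) i + (n : ℤ)})
    (hbig : ∀ a, big a = {x : Site 3 | ∀ i, planeEmb 3 ((n : ℤ) • a) i - (n : ℤ) ≤ x i ∧
      x i ≤ planeEmb 3 ((n : ℤ) • a) i + 2 * (n : ℤ)})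
    (hinf : (openCluster
        {e : Sym2 (Site 2) | e ∈ (zdGraph 2).edgeSet ∧ ∀ a ∈ e,
          (∀ i : Fin 3, ω ∈ {ω : BondConfig (Site 3) | ∃ x y : Site 3,
            x i = (planeEmb 3 ((n : ℤ) • a)) i ∧ y i = (planeEmb 3 ((n : ℤ) • a)) i + (n : ℤ) ∧
            PathIn (zdGraph 3) (quietSet R ω ∩ cube a) x y}) ∧
          ω ∉ {ω : BondConfig (Site 3) | ∃ x y : Site 3,
            (∃ z : Site 3, PathIn (zdGraph 3) (quietSet R ω ∩ big a) x z ∧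
              ∃ i : Fin 3, (n : ℤ) ≤ |z i - x i|) ∧
            (∃ z : Site 3, PathIn (zdGraph 3) (quietSet R ω ∩ big a) y z ∧
              ∃ i : Fin 3, (n : ℤ) ≤ |z i - y i|) ∧
            ¬ PathIn (zdGraph 3) (quietSet R ω ∩ big a) x y}}
        (0 : Site 2)).Infinite) :
    ω ∈ finiteClustersPercolate (zdGraph 3) := by
  -- `Far a x`: `x` is joined inside the doubled cube of `a` to a quiet site at sup-distance `≥ n`
  obtain ⟨Far, hFar⟩ : ∃ Far : Site 2 → Site 3 → Prop, ∀ a x, Far a x ↔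
      ∃ z : Site 3, PathIn (zdGraph 3) (quietSet R ω ∩ big a) x z ∧
        ∃ i : Fin 3, (n : ℤ) ≤ |z i - x i| :=
    ⟨_, fun _ _ => Iff.rfl⟩
  -- `Good a`: a `0`-crossing of the cube of `a` and uniqueness in its doubled cube
  obtain ⟨Good, hGood⟩ : ∃ Good : Site 2 → Prop, ∀ a, Good a ↔
      (∃ x y : Site 3, x 0 = planeEmb 3 ((n : ℤ) • a) 0 ∧
        y 0 = planeEmb 3 ((n : ℤ) • a) 0 + (n : ℤ) ∧
        PathIn (zdGraph 3) (quietSet R ω ∩ cube a) x y) ∧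
      ∀ x y, Far a x → Far a y → PathIn (zdGraph 3) (quietSet R ω ∩ big a) x y :=
    ⟨_, fun _ => Iff.rfl⟩
  -- the coarse configuration, abstractly: open edges are lattice edges with good endpoints
  obtain ⟨BC, hinf', hBC⟩ : ∃ BC : BondConfig (Site 2), (openCluster BC (0 : Site 2)).Infinite ∧
      ∀ u v, (openGraph BC).Adj u v → (zdGraph 2).Adj u v ∧ Good u ∧ Good v := by
    refine ⟨_, hinf, fun u v huv => ?_⟩
    rw [openGraph_adj] at huv
    obtain ⟨⟨hE, hg⟩, -⟩ := huv
    have key : ∀ a ∈ s(u, v), Good a := fun a ha =>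
      (hGood a).2 ⟨(hg a ha).1 0, fun x y hx hy => by
        by_contra hxy
        exact (hg a ha).2 ⟨x, y, (hFar a x).1 hx, (hFar a y).1 hy, hxy⟩⟩
    exact ⟨(SimpleGraph.mem_edgeSet _).1 hE, key u (Sym2.mem_mk_left u v),
      key v (Sym2.mem_mk_right u v)⟩
  -- cubes inside doubled cubes
  have hcb : ∀ a : Site 2, cube a ⊆ big a := fun a => by
    rw [hcube, hbig]
    exact cube_subset_bigCube_self n a
  have hcb' : ∀ a b : Site 2, (zdGraph 2).Adj a b → cube b ⊆ big a := fun a b h => by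
    rw [hcube, hbig]
    exact cube_subset_bigCube n h
  -- the start of the `0`-crossing of a good cube is far-reaching in every doubled cube around it
  have hfar2 : ∀ a b, Good b → cube b ⊆ big a → ∃ x ∈ cube b, Far a x ∧ Far b x := by
    intro a b hb hsub
    obtain ⟨⟨x, y, hx, hy, hP⟩, -⟩ := (hGood b).1 hb
    have hdist : ∃ i : Fin 3, (n : ℤ) ≤ |y i - x i| :=
      ⟨0, by rw [hy, hx, add_sub_cancel_left, Nat.abs_cast]⟩
    exact ⟨x, hP.left_mem.2,
      (hFar a x).2 ⟨y, hP.mono (inter_subset_inter_right _ hsub), hdist⟩,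
      (hFar b x).2 ⟨y, hP.mono (inter_subset_inter_right _ (hcb b)), hdist⟩⟩
  -- far-reaching points of a good block are joined through quiet sites
  have hjoin : ∀ a x y, Good a → Far a x → Far a y → PathIn (zdGraph 3) (quietSet R ω) x y :=
    fun a x y ha hx hy => (((hGood a).1 ha).2 x y hx hy).mono inter_subset_left
  -- an open coarse edge carries a point far-reaching for both endpoints
  have hedge : ∀ u v, (openGraph BC).Adj u v → Good v ∧ ∃ z, Far u z ∧ Far v z := by
    intro u v huv
    obtain ⟨hadj, -, hv⟩ := hBC u v huv
    obtain ⟨z, -, hzu, hzv⟩ := hfar2 u v hv (hcb' u v hadj)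
    exact ⟨hv, z, hzu, hzv⟩
  -- the coarse origin is good: the infinite cluster has an edge at `0`
  obtain ⟨a, ha, ha0⟩ := hinf'.exists_notMem_finset {0}
  have h0 : Good 0 := by
    have hr : (openGraph BC).Reachable 0 a := ha
    rw [SimpleGraph.reachable_iff_reflTransGen] at hr
    rcases hr.cases_head with h | ⟨c, h0c, -⟩
    · exact absurd (Finset.mem_singleton.2 h.symm) ha0
    · exact (hBC 0 c h0c).2.1
  obtain ⟨x₀, -, hx₀, -⟩ := hfar2 0 0 h0 (hcb 0)
  -- every coarse site of the cluster is good, its far-reaching points joined to `x₀`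
  have hclaim : ∀ v ∈ openCluster BC (0 : Site 2),
      Good v ∧ ∀ x, Far v x → PathIn (zdGraph 3) (quietSet R ω) x₀ x :=
    fun v hv => pathIn_of_reachable hjoin hedge h0 hx₀ hv
  -- infinitely many sites joined to `x₀` through quiet sites (cubes are finite-to-one)
  have hT : {x : Site 3 | PathIn (zdGraph 3) (quietSet R ω) x₀ x}.Infinite := by
    intro hT
    apply hinf'
    refine (hT.biUnion fun x _ => finite_fibre3 hn x).subset fun v hv => ?_
    obtain ⟨hv1, hv2⟩ := hclaim v hv
    obtain ⟨x, hxc, hxv, -⟩ := hfar2 v v hv1 (hcb v)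
    rw [hcube] at hxc
    exact mem_biUnion (hv2 x hxv) hxc
  -- these sites lie in the `X`-cluster of `x₀`
  exact ⟨x₀, hT.mono fun x hx => reachable_finiteClusters_of_pathIn hω hx⟩

end SPPBlocksToVacant

/-- **Registered stub `stub_blocksToVacant` (gluing by uniqueness).** For the one-scale block
renormalisation of the vacant set of `ℤ³` (coarse site `a ∈ ℤ²` good iff its cube `n a + [0, n]³`
is crossed in every direction by lattice paths of `R`-quiet sites and its doubled cube
`n a + [-n, 2n]³` has no two unjoined far-reaching quiet pieces; coarse edge open iff both
endpoints good), an infinite open coarse cluster of the coarse origin (`n ≥ 1`, `ω ⊆ E(ℤ³)`) gives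
an infinite connected component of GHK's graph `X = ℤ³[{C finite}]`, i.e.
`ω ∈ finiteClustersPercolate (zdGraph 3)`.
[cite: GrimmettHolroydKozma2014, §4 (proof of Thm. 5, "there exists an infinite component in Γ")] -/
theorem stub_blocksToVacant :
    ∀ (n R : ℕ) (ω : BondConfig (Site 3)), 1 ≤ n → ω ⊆ (zdGraph 3).edgeSet →
      (openCluster
          {e : Sym2 (Site 2) | e ∈ (zdGraph 2).edgeSet ∧ ∀ a ∈ e,
            (∀ i : Fin 3, ω ∈ {ω : BondConfig (Site 3) | ∃ x y : Site 3, x i = (planeEmb 3 ((n : ℤ) • a)) i ∧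
              y i = (planeEmb 3 ((n : ℤ) • a)) i + (n : ℤ) ∧
              PathIn (zdGraph 3) (quietSet R ω ∩ {x : Site 3 | ∀ i, (planeEmb 3 ((n : ℤ) • a)) i ≤ x i ∧
                x i ≤ (planeEmb 3 ((n : ℤ) • a)) i + (n : ℤ)}) x y}) ∧
            ω ∉ {ω : BondConfig (Site 3) | ∃ x y : Site 3,
              (∃ z : Site 3, PathIn (zdGraph 3) (quietSet R ω ∩ {x : Site 3 | ∀ i, (planeEmb 3 ((n : ℤ) • a)) i - (n : ℤ) ≤ x i ∧
                x i ≤ (planeEmb 3 ((n : ℤ) • a)) i + 2 * (n : ℤ)}) x z ∧ ∃ i : Fin 3, (n : ℤ) ≤ |z i - x i|) ∧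
              (∃ z : Site 3, PathIn (zdGraph 3) (quietSet R ω ∩ {x : Site 3 | ∀ i, (planeEmb 3 ((n : ℤ) • a)) i - (n : ℤ) ≤ x i ∧
                x i ≤ (planeEmb 3 ((n : ℤ) • a)) i + 2 * (n : ℤ)}) y z ∧ ∃ i : Fin 3, (n : ℤ) ≤ |z i - y i|) ∧
              ¬ PathIn (zdGraph 3) (quietSet R ω ∩ {x : Site 3 | ∀ i, (planeEmb 3 ((n : ℤ) • a)) i - (n : ℤ) ≤ x i ∧
                x i ≤ (planeEmb 3 ((n : ℤ) • a)) i + 2 * (n : ℤ)}) x y}}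
          (0 : Site 2)).Infinite →
      ω ∈ finiteClustersPercolate (zdGraph 3) := by
  intro n R ω hn hω hinf
  exact SPPBlocksToVacant.mem_finiteClustersPercolate_of_blocks hn hω
    (fun a => {x : Site 3 | ∀ i, (planeEmb 3 ((n : ℤ) • a)) i ≤ x i ∧
      x i ≤ (planeEmb 3 ((n : ℤ) • a)) i + (n : ℤ)})
    (fun a => {x : Site 3 | ∀ i, (planeEmb 3 ((n : ℤ) • a)) i - (n : ℤ) ≤ x i ∧
      x i ≤ (planeEmb 3 ((n : ℤ) • a)) i + 2 * (n : ℤ)})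
    (fun _ => rfl) (fun _ => rfl) hinf

end Summit.CriticalPhenomena.PercolationContinuityZ3.Theorems
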